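import Mathlib.Analysis.Calculus.Deriv.Star
import Literature.NumberTheory.Automorphic.AutomorphicForms
import Literature.NumberTheory.Automorphic.HeckeAlgebra
import HarnessLib

/-!
# The complex conjugate `π̄` of an automorphic representation datum (Borel–Jacquet model)

Topic `NumberTheory/Automorphic`, namespace `Literature.NumberTheory.Automorphic`. For an
automorphy datum `𝒟 : AutomorphyDatum 𝒢 A N` (accepted `AutomorphicForms`: Borel–Jacquet 1979, §4)
and an automorphic representation `π = W / W'` in the sense of the tree
(`AutomorphicRepData 𝒟`: `W' < W` stable subspaces of the space of automorphic forms, no stable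
subspace strictly in between), this file constructs the **complex conjugate representation**
`π̄ = W̄ / W̄'`, `W̄ = {φ̄ : φ ∈ W}` (`AutomorphicRepData.conj`), the object entering Clozel's
theory of `Aut(ℂ)`-conjugates at `σ = c` (Clozel 1990, §3.1: `^cπ`; Patrikis 2019, proof of
Cor. 3.2.3: "the `L²` inner product then implies that `π^∨ ≅ ^cπ`") — in the Borel–Jacquet model of
the tree rather than in `L²` (the `L²` version is `CuspidalAutomorphicRepGL.conj` of
`AutomorphicConjugate`). Everything is PROVED; there is no named fact and no `sorry`.

* `conjSubmodule W = {φ | φ̄ ∈ W}` for a complex subspace `W` of functions `X → ℂ`: an involution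
  of the lattice of subspaces (`conjSubmodule_conjSubmodule`, `conjSubmodule_le_iff`,
  `conjSubmodule_lt_conjSubmodule`), `conjSubmodule (span S) = span S̄` (`conjSubmodule_span`) and
  finite-dimensionality is preserved (`finiteDimensional_conjSubmodule`).
* Archimedean calculus commutes with conjugation (Borel–Jacquet 1979, §1: the Lie algebra is
  REAL, so `X φ̄ = \overline{X φ}`): `IsArchSmooth.star`, `lieDeriv_star`, `iterLieDeriv_star`,
  `applyFree_star` (central words have real coefficients), `IsZFinite.star`, `IsKFinite.star`.
* Automorphic forms: `IsAutomorphicForm.star`, `star_mem_automorphicForms`,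
  `IsStableSubmodule.conj`; and `AutomorphicRepData.conj π = π̄` with `conj_conj`.
* Hecke operators are real: `[U g U] φ̄ = \overline{[U g U] φ}` for right translation
  (`heckeOperator_rightTranslation_star`, any `U`, `g`; both sides are the junk value `0` when
  `UgU/U` is infinite).

The `GL_n`-specific consequences (cusp forms, Satake parameters `α ↦ ᾱ`, Clozel's relation
`IsAutConjugate c π π̄`) are in `ClozelAlgebraicityComplexConjProofs`.

Design: no `open scoped ComplexConjugate` (the notation `conj` would capture the identifier
`AutomorphicRepData.conj`); conjugation of functions is Mathlib's pointwise `star`.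

## References

* A. Borel, H. Jacquet, *Automorphic forms and automorphic representations*, Proc. Sympos. Pure
  Math. 33 (Corvallis 1979), part 1, §1.1–1.6, §4.2–4.6 [BorelJacquet1979].
* L. Clozel, *Motifs et formes automorphes: applications du principe de fonctorialité*, in
  Automorphic forms, Shimura varieties, and L-functions I (Ann Arbor 1988), Academic Press 1990,
  §3.1 [Clozel1990].
* S. Patrikis, *Variations on a theorem of Tate*, Mem. AMS 258 (2019) = arXiv:1207.6724,
  Cor. 3.2.3 [Patrikis2019].
-/

-- Mathlib idiom (Mathlib/Algebra/Lie/OfAssociative.lean), exactly as in `AutomorphicForms` and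
-- `ArchimedeanCalculus`: the commutator Lie ring on matrices, needed to mention `H.lie`, `𝒟.arch.lie`.
attribute [local instance 100] LieRing.ofAssociativeRing

open scoped MatrixGroups Matrix ContDiff

noncomputable section

namespace Literature.NumberTheory.Automorphic

/-! ### The conjugate of a complex subspace of functions -/

section ConjSubmodule

variable {X : Type*}

/-- The **complex conjugate** `W̄ = {φ | φ̄ ∈ W}` (`= {ψ̄ : ψ ∈ W}`) of a complex subspace `W` of
functions `X → ℂ`; again a complex subspace since `\overline{c φ} = c̄ φ̄`. (Clozel 1990, §3.1,
`^cπ`; Borel–Jacquet 1979, §4.6.) [folklore] -/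
def conjSubmodule (W : Submodule ℂ (X → ℂ)) : Submodule ℂ (X → ℂ) where
  carrier := {φ | star φ ∈ W}
  zero_mem' := by
    simp only [Set.mem_setOf_eq, star_zero]
    exact W.zero_mem
  add_mem' {φ ψ} hφ hψ := by
    simp only [Set.mem_setOf_eq, star_add] at hφ hψ ⊢
    exact W.add_mem hφ hψ
  smul_mem' c {φ} hφ := by
    simp only [Set.mem_setOf_eq, star_smul] at hφ ⊢
    exact W.smul_mem (star c) hφ

/-- Membership in the conjugate subspace: `φ ∈ W̄ ↔ φ̄ ∈ W` (definitional). [folklore] -/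
theorem mem_conjSubmodule_iff (W : Submodule ℂ (X → ℂ)) (φ : X → ℂ) :
    φ ∈ conjSubmodule W ↔ star φ ∈ W :=
  Iff.rfl

/-- `φ̄ ∈ W̄ ↔ φ ∈ W`. [folklore] -/
theorem star_mem_conjSubmodule_iff (W : Submodule ℂ (X → ℂ)) (φ : X → ℂ) :
    star φ ∈ conjSubmodule W ↔ φ ∈ W := by
  rw [mem_conjSubmodule_iff, star_star]

/-- Conjugation of subspaces is an involution: `\overline{W̄} = W`. [folklore] -/
@[simp]
theorem conjSubmodule_conjSubmodule (W : Submodule ℂ (X → ℂ)) :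
    conjSubmodule (conjSubmodule W) = W := by
  ext φ
  rw [mem_conjSubmodule_iff, star_mem_conjSubmodule_iff]

/-- Conjugation of subspaces is monotone. [folklore] -/
theorem conjSubmodule_mono {W₁ W₂ : Submodule ℂ (X → ℂ)} (h : W₁ ≤ W₂) :
    conjSubmodule W₁ ≤ conjSubmodule W₂ :=
  fun _ hφ ↦ h hφ

/-- `W̄₁ ≤ W₂ ↔ W₁ ≤ W̄₂`. [folklore] -/
theorem conjSubmodule_le_iff {W₁ W₂ : Submodule ℂ (X → ℂ)} :
    conjSubmodule W₁ ≤ W₂ ↔ W₁ ≤ conjSubmodule W₂ := by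
  constructor
  · intro h φ hφ
    exact h ((star_mem_conjSubmodule_iff W₁ φ).mpr hφ)
  · intro h φ hφ
    have h' := h hφ
    rwa [star_mem_conjSubmodule_iff] at h'

/-- `W̄₁ ≤ W̄₂ ↔ W₁ ≤ W₂`. [folklore] -/
theorem conjSubmodule_le_conjSubmodule_iff {W₁ W₂ : Submodule ℂ (X → ℂ)} :
    conjSubmodule W₁ ≤ conjSubmodule W₂ ↔ W₁ ≤ W₂ := by
  rw [conjSubmodule_le_iff, conjSubmodule_conjSubmodule]

/-- Conjugation of subspaces is strictly monotone. [folklore] -/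
theorem conjSubmodule_lt_conjSubmodule {W₁ W₂ : Submodule ℂ (X → ℂ)} (h : W₁ < W₂) :
    conjSubmodule W₁ < conjSubmodule W₂ :=
  lt_of_le_of_ne (conjSubmodule_mono h.le) fun he ↦ h.ne (by
    rw [← conjSubmodule_conjSubmodule W₁, he, conjSubmodule_conjSubmodule])

/-- The conjugate of an element of `span S` lies in `span S̄`. [folklore] -/
theorem star_mem_span_image_star {S : Set (X → ℂ)} {φ : X → ℂ} (hφ : φ ∈ Submodule.span ℂ S) :
    star φ ∈ Submodule.span ℂ (star '' S) := by
  induction hφ using Submodule.span_induction with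
  | mem ψ hψ => exact Submodule.subset_span ⟨ψ, hψ, rfl⟩
  | zero =>
    rw [star_zero]
    exact Submodule.zero_mem _
  | add ψ₁ ψ₂ _ _ h₁ h₂ =>
    rw [star_add]
    exact Submodule.add_mem _ h₁ h₂
  | smul c ψ _ h =>
    rw [star_smul]
    exact Submodule.smul_mem _ _ h

/-- `\overline{span S} = span S̄`. [folklore] -/
theorem conjSubmodule_span (S : Set (X → ℂ)) :
    conjSubmodule (Submodule.span ℂ S) = Submodule.span ℂ (star '' S) := by
  apply le_antisymm
  · intro φ hφ
    have h := star_mem_span_image_star hφ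
    rwa [star_star] at h
  · rw [Submodule.span_le]
    rintro _ ⟨ψ, hψ, rfl⟩
    exact (star_mem_conjSubmodule_iff _ _).mpr (Submodule.subset_span hψ)

/-- The conjugate of a finite-dimensional subspace is finite-dimensional (`W = span s` with `s`
finite, `W̄ = span s̄`). [folklore] -/
theorem finiteDimensional_conjSubmodule (W : Submodule ℂ (X → ℂ)) [FiniteDimensional ℂ W] :
    FiniteDimensional ℂ (conjSubmodule W) := by
  obtain ⟨s, rfl⟩ := (Submodule.fg_iff_finiteDimensional W).mpr ‹_›
  rw [conjSubmodule_span]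
  exact FiniteDimensional.span_of_finite ℂ (s.finite_toSet.image star)

end ConjSubmodule

/-! ### Archimedean calculus commutes with conjugation (the Lie algebra is real) -/

section ArchStar

variable {A : Type*} [NormedCommRing A] [NormedAlgebra ℝ A] [NormedAlgebra ℚ A] [CompleteSpace A]
  [StarRing A] {N : Type*} [Fintype N] [DecidableEq N] {H : RealMatrixGroup A N}
  {G : Type*} [Group G] {ι : H.carrier →* G}

/-- Right archimedean translation commutes with conjugation: `r(h) φ̄ = \overline{r(h) φ}`.
Borel–Jacquet 1979, §1.3. [folklore] -/
theorem archTranslate_star (h : H.carrier) (φ : G → ℂ) :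
    archTranslate ι h (star φ) = star (archTranslate ι h φ) :=
  rfl

open scoped Matrix.Norms.Operator in
/-- A function smooth in the archimedean variable has a smooth conjugate (conjugation is a
continuous real-linear map of `ℂ`). Borel–Jacquet 1979, §1.1. [folklore] -/
theorem IsArchSmooth.star {φ : G → ℂ} (hφ : IsArchSmooth ι φ) : IsArchSmooth ι (star φ) := by
  intro g
  change ContDiff ℝ ∞ fun X : H.lie.toSubmodule ↦ Complex.conjCLE (φ (g * ι (H.expMem ⟨X, X.2⟩)))
  exact Complex.conjCLE.contDiff.comp (hφ g)

variable (ι) in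
/-- The Lie derivative commutes with conjugation, `X φ̄ = \overline{X φ}`, for `X` in the REAL
Lie algebra `𝔤` (derivative of a conjugate, including the junk value `0`).
Borel–Jacquet 1979, §1.5. [folklore] -/
theorem lieDeriv_star (X : H.lie) (φ : G → ℂ) : lieDeriv ι X (star φ) = star (lieDeriv ι X φ) := by
  funext g
  simp only [lieDeriv, Pi.star_apply]
  exact deriv.star

variable (ι) in
/-- Iterated Lie derivatives commute with conjugation. Borel–Jacquet 1979, §1.5. [folklore] -/
theorem iterLieDeriv_star (w : List H.lie) (φ : G → ℂ) :
    iterLieDeriv ι w (star φ) = star (iterLieDeriv ι w φ) := by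
  induction w with
  | nil => rfl
  | cons X w ih => rw [iterLieDeriv_cons, iterLieDeriv_cons, ih, lieDeriv_star]

variable (ι) in
/-- The word action of `ℝ⟨𝔤⟩` commutes with conjugation, `p φ̄ = \overline{p φ}`: the
coefficients of `p` are real. Borel–Jacquet 1979, §1.5–1.6. [folklore] -/
theorem applyFree_star (p : FreeAlgebra ℝ H.lie) (φ : G → ℂ) :
    applyFree ι p (star φ) = star (applyFree ι p φ) := by
  simp only [applyFree, Finsupp.sum, star_sum, star_smul, iterLieDeriv_star, RCLike.star_def,
    Complex.conj_ofReal]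

variable (ι) in
/-- The `Z(𝔤)`-orbit span of `φ̄` is contained in the conjugate of that of `φ`.
Borel–Jacquet 1979, §1.6. [folklore] -/
theorem zOrbitSpan_star_le (φ : G → ℂ) :
    zOrbitSpan ι (star φ) ≤ conjSubmodule (zOrbitSpan ι φ) := by
  rw [zOrbitSpan, Submodule.span_le]
  rintro _ ⟨p, hp, rfl⟩
  rw [SetLike.mem_coe, mem_conjSubmodule_iff, applyFree_star, star_star]
  exact Submodule.subset_span ⟨p, hp, rfl⟩

/-- `Z(𝔤)`-finiteness is preserved by conjugation. Borel–Jacquet 1979, §1.6 and §4.2(c). [folklore] -/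
theorem IsZFinite.star {φ : G → ℂ} (hφ : IsZFinite ι φ) : IsZFinite ι (star φ) := by
  haveI : FiniteDimensional ℂ (zOrbitSpan ι φ) := hφ
  haveI := finiteDimensional_conjSubmodule (zOrbitSpan ι φ)
  exact Submodule.finiteDimensional_of_le (zOrbitSpan_star_le ι φ)

variable (ι) in
/-- The span of the `K`-translates of `φ̄` is contained in the conjugate of that of `φ`.
Borel–Jacquet 1979, §1.3. [folklore] -/
theorem kTranslateSpan_star_le (φ : G → ℂ) :
    kTranslateSpan ι (star φ) ≤ conjSubmodule (kTranslateSpan ι φ) := by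
  rw [kTranslateSpan, Submodule.span_le]
  rintro _ ⟨k, rfl⟩
  rw [SetLike.mem_coe, mem_conjSubmodule_iff]
  dsimp only
  rw [archTranslate_star, star_star]
  exact archTranslate_mem_kTranslateSpan ι k φ

/-- `K`-finiteness is preserved by conjugation. Borel–Jacquet 1979, §1.3 and §4.2(b). [folklore] -/
theorem IsKFinite.star {φ : G → ℂ} (hφ : IsKFinite ι φ) : IsKFinite ι (star φ) := by
  haveI : FiniteDimensional ℂ (kTranslateSpan ι φ) := hφ
  haveI := finiteDimensional_conjSubmodule (kTranslateSpan ι φ)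
  exact Submodule.finiteDimensional_of_le (kTranslateSpan_star_le ι φ)

end ArchStar

/-! ### Automorphic forms and stable subspaces under conjugation -/

section Forms

variable {K : Type} [Field K] [NumberField K]
  {A : Type*} [NormedCommRing A] [NormedAlgebra ℝ A] [NormedAlgebra ℚ A] [CompleteSpace A]
  [StarRing A] {N : Type*} [Fintype N] [DecidableEq N] {𝒢 : AdelicGroupData K}

/-- Right translation commutes with conjugation: `r(h) φ̄ = \overline{r(h) φ}`.
Borel–Jacquet 1979, §4.3. [folklore] -/
theorem rightTranslation_star (h : 𝒢.Adelic) (φ : 𝒢.Adelic → ℂ) :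
    rightTranslation 𝒢 h (star φ) = star (rightTranslation 𝒢 h φ) :=
  rfl

/-- Left `G(K)`-invariance is preserved by conjugation. Borel–Jacquet 1979, §4.2(a). [folklore] -/
theorem IsLeftInvariant.star {φ : 𝒢.Adelic → ℂ} (hφ : IsLeftInvariant 𝒢 φ) :
    IsLeftInvariant 𝒢 (star φ) :=
  fun γ hγ g ↦ by simp only [Pi.star_apply, hφ γ hγ g]

/-- Right invariance under a subgroup is preserved by conjugation. Borel–Jacquet 1979, §4.2(a). [folklore] -/
theorem IsRightInvariantUnder.star {G : Type*} [Group G] {U : Subgroup G} {φ : G → ℂ}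
    (hφ : IsRightInvariantUnder U φ) : IsRightInvariantUnder U (star φ) :=
  fun u hu g ↦ by simp only [Pi.star_apply, hφ u hu g]

variable (𝒟 : AutomorphyDatum 𝒢 A N)

/-- Moderate growth is preserved by conjugation (`‖φ̄ g‖ = ‖φ g‖`). Borel–Jacquet 1979, §4.2(d). [folklore] -/
theorem HasModerateGrowth.star {φ : 𝒢.Adelic → ℂ} (hφ : HasModerateGrowth 𝒟 φ) :
    HasModerateGrowth 𝒟 (star φ) := by
  obtain ⟨C, r, h⟩ := hφ
  refine ⟨C, r, fun g ↦ ?_⟩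
  rw [Pi.star_apply, norm_star]
  exact h g

/-- **The conjugate of an automorphic form is an automorphic form**: left invariance, the level,
moderate growth are evidently preserved, and smoothness, `K_∞`- and `Z(𝔤)`-finiteness in the
archimedean variable are preserved because `K_∞` acts through right translations and `𝔤`, `Z(𝔤)`
are REAL (`lieDeriv_star`, `applyFree_star`). Borel–Jacquet 1979, 4.2; Clozel 1990, §3.1 (`^cπ`). [cite: BorelJacquet1979, 4.2] -/
theorem IsAutomorphicForm.star {φ : 𝒢.Adelic → ℂ} (hφ : IsAutomorphicForm 𝒟 φ) :
    IsAutomorphicForm 𝒟 (star φ) where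
  leftInvariant := hφ.leftInvariant.star
  exists_level :=
    let ⟨U, hU, hUφ⟩ := hφ.exists_level
    ⟨U, hU, hUφ.star⟩
  archSmooth := hφ.archSmooth.star
  kFinite := hφ.kFinite.star
  zFinite := hφ.zFinite.star
  moderateGrowth := hφ.moderateGrowth.star

/-- The space of automorphic forms is stable under conjugation. Borel–Jacquet 1979, 4.2–4.3. [folklore] -/
theorem star_mem_automorphicForms {φ : 𝒢.Adelic → ℂ} (hφ : φ ∈ automorphicForms 𝒟) :
    star φ ∈ automorphicForms 𝒟 := by
  refine Submodule.span_mono ?_ (star_mem_span_image_star hφ)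
  rintro _ ⟨ψ, hψ, rfl⟩
  exact IsAutomorphicForm.star 𝒟 hψ

/-- **The conjugate of a `(𝔤, K_∞) × G(𝔸_f)`-stable subspace of automorphic forms is stable**
(right translations and real Lie derivatives commute with conjugation).
Borel–Jacquet 1979, 4.3 and 4.6; Clozel 1990, §3.1. [folklore] -/
theorem IsStableSubmodule.conj {W : Submodule ℂ (𝒢.Adelic → ℂ)} (hW : IsStableSubmodule 𝒟 W) :
    IsStableSubmodule 𝒟 (conjSubmodule W) where
  le_automorphicForms φ hφ := by
    have h := star_mem_automorphicForms 𝒟 (hW.le_automorphicForms hφ)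
    rwa [star_star] at h
  finite_stable h hh φ hφ := by
    change star (rightTranslation 𝒢 h φ) ∈ W
    rw [← rightTranslation_star]
    exact hW.finite_stable h hh hφ
  k_stable k φ hφ := by
    change star (rightTranslation 𝒢 (𝒟.ofK k) φ) ∈ W
    rw [← rightTranslation_star]
    exact hW.k_stable k hφ
  lie_stable X φ hφ := by
    change star (lieDeriv 𝒟.ofArch X φ) ∈ W
    rw [← lieDeriv_star]
    exact hW.lie_stable X _ hφ

/-- **Hecke operators are real**: for right translation, every double-coset operator `[U g U]`
(a sum of right translates over `UgU/U`; the junk value `0` when this is infinite) commutes with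
conjugation, `[U g U] φ̄ = \overline{[U g U] φ}`. (Shimura 1971, §3.4; Clozel 1990, §3.1: the
unramified Hecke algebra acts on `^σπ_f` through `σ`.) [folklore] -/
theorem heckeOperator_rightTranslation_star (U : Subgroup 𝒢.Adelic) (g : 𝒢.Adelic)
    (φ : 𝒢.Adelic → ℂ) :
    heckeOperator (rightTranslation 𝒢) U g (star φ) =
      star (heckeOperator (rightTranslation 𝒢) U g φ) := by
  rw [heckeOperator]
  revert φ
  refine finsum_mem_induction (fun T : Module.End ℂ (𝒢.Adelic → ℂ) ↦
    ∀ φ : 𝒢.Adelic → ℂ, T (star φ) = star (T φ)) ?_ ?_ ?_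
  · intro φ
    simp only [LinearMap.zero_apply, star_zero]
  · intro T₁ T₂ h₁ h₂ φ
    simp only [LinearMap.add_apply, h₁ φ, h₂ φ, star_add]
  · intro y _ φ
    rfl

namespace AutomorphicRepData

variable {𝒟}

/-- **The complex conjugate `π̄ = W̄ / W̄'` of an automorphic representation `π = W / W'`**: the
conjugate subspaces are again stable subspaces of the space of automorphic forms, `W̄' < W̄`, and
`W̄ / W̄'` is irreducible because conjugation is an involutive order isomorphism of stable
subspaces. This is Clozel's `^cπ` (Clozel 1990, §3.1; Patrikis 2019, proof of Cor. 3.2.3: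
`π^∨ ≅ ^cπ` for unitary `π`), in the Borel–Jacquet model `W / W'` of the tree. [cite: Clozel1990, §3.1] -/
def conj (π : AutomorphicRepData 𝒟) : AutomorphicRepData 𝒟 where
  W := conjSubmodule π.W
  W' := conjSubmodule π.W'
  lt := conjSubmodule_lt_conjSubmodule π.lt
  stable := π.stable.conj
  stable' := π.stable'.conj
  irreducible W'' h₁ h₂ hst := by
    have h₁' : π.W' ≤ conjSubmodule W'' := by
      simpa only [conjSubmodule_conjSubmodule] using conjSubmodule_mono h₁
    have h₂' : conjSubmodule W'' ≤ π.W := conjSubmodule_le_iff.mpr h₂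
    rcases π.irreducible _ h₁' h₂' (hst.conj 𝒟) with h | h
    · left
      rw [← conjSubmodule_conjSubmodule W'', h]
    · right
      rw [← conjSubmodule_conjSubmodule W'', h]

/-- The forms of `π̄` are the conjugates of the forms of `π` (definitional). [folklore] -/
@[simp]
theorem conj_W (π : AutomorphicRepData 𝒟) : π.conj.W = conjSubmodule π.W :=
  rfl

/-- The subspace `W̄'` of `π̄` (definitional). [folklore] -/
@[simp]
theorem conj_W' (π : AutomorphicRepData 𝒟) : π.conj.W' = conjSubmodule π.W' :=
  rfl

/-- `\overline{π̄} = π`: conjugation of automorphic representations is an involution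
(Clozel 1990, §3.1: `σ ↦ ^σπ` is an action, `c² = 1`). [folklore] -/
@[simp]
theorem conj_conj (π : AutomorphicRepData 𝒟) : π.conj.conj = π := by
  cases π
  simp only [conj, conjSubmodule_conjSubmodule]

end AutomorphicRepData

end Forms

end Literature.NumberTheory.Automorphic
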